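import Summits.ResolutionOfSingularities.ResolutionOfSingularities.Theses.CyclicCovers
import Summits.ResolutionOfSingularities.ResolutionOfSingularities.Theses.Valuative
import Summits.ResolutionOfSingularities.ResolutionOfSingularities.Theorems.ValuativeTorsorToLurelOfTemkin

/-!
# Line `via-torsor-to-lurel` for crux `CyclicCovers.AbhyankarReduction` (stmt-ResolutionOfSingularities-13707)

REDIRECT (crux-strategist r1, 2026-08-17). The crux

  `AbhyankarReduction := AsAscentRel → EluRegular → ∀ p, p.Prime → TORSOR_p → LUrel_p`

is, by `Iff.rfl`, the statement `AsAscentRel → EluRegular → Valuative.TorsorToLurel`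
(`abhyankarReduction_iff`), hence it is implied OUTRIGHT by route Valuative's item
`TorsorToLurel` (stmt-ResolutionOfSingularities-10968) with the two Cossart–Piltant hypotheses
unused (`abhyankarReduction_of_torsorToLurel`). `TorsorToLurel` is reduced IN TREE
(`Theorems/ValuativeTorsorToLurelOfTemkin.lean`, `torsorToLurel_of_smoothFibre`) to the single
remaining leaf of the tree's proof cone of Temkin's inseparable local uniformization theorem
(Temkin 2013 = arXiv:0804.1554v3 Thm. 1.3.2): the named fact
`Literature.AlgebraicGeometry.Resolution.Temkin2013RelativeCurveSmoothFibre` (Thm. 3.3.1 for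
`k`-smooth generic fibres), itself reduced in tree to the algebraization input (J2)
(`Temkin2013RelativeCurveSmoothFibre.of_algebraization`, `RelativeCurveSmoothFibreFromJ2.lean`).

So the whole crux is ONE stub: the Literature leaf. No Artin–Schreier ascent, no ELU, no tame
descent (Kuhlmann 2000 OP11) is needed; see `STRATEGY-CENSUS.md` of this crux directory.
-/

set_option linter.dupNamespace false

open Literature.AlgebraicGeometry.Resolution

namespace Summit.ResolutionOfSingularities.ResolutionOfSingularities.Cruxes.AbhyankarReduction.ViaTorsorToLurel

open Summit.ResolutionOfSingularities.ResolutionOfSingularities.Theses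

/-! ## Skeleton (one registered stub = the Literature leaf; composition kernel-checked)

`#h21_check_skeleton` convention: exactly ONE theorem of this file — `AbhyankarReduction_of` —
concludes the crux BY NAME and takes no hypotheses; it reaches the stub by name. The
hypothesis-form `AbhyankarReduction_of_stubs` spells its conclusion UNFOLDED on purpose. -/

/-- STUB (the only one): Temkin 2013, Thm. 3.3.1 for `k`-smooth generic fibres — the last leaf
of the tree's `Temkin2013` cone; in tree it is `(J2) → leaf`
(`Temkin2013RelativeCurveSmoothFibre.of_algebraization`), (J2) = the algebraization, Steps 2–4
of the printed proof (common smooth roof from the Hensel chart and the standard-étale chart),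
under construction in the `RelativeCurveChart*` / `DChart*` / `EChart` / `RoofInField` series.
Do NOT re-formalize it under this crux: take the blocker from the Temkin2013 Literature unit. -/
theorem stub_smoothFibreLeaf : Temkin2013RelativeCurveSmoothFibre.{0} := by
  sorry

/-- Hypothesis form of the composition (conclusion = the crux UNFOLDED, by `Iff.rfl`):
the leaf gives `AsAscentRel → EluRegular → Valuative.TorsorToLurel` through the landed
`Theorems.torsorToLurel_of_smoothFibre`; the two Cossart–Piltant hypotheses are discarded. -/
theorem AbhyankarReduction_of_stubs (hsf : Temkin2013RelativeCurveSmoothFibre.{0}) :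
    CyclicCovers.AsAscentRel → CyclicCovers.EluRegular → Valuative.TorsorToLurel :=
  fun _ _ => Theorems.torsorToLurel_of_smoothFibre hsf

/-- **The skeleton theorem**: the crux BY NAME, from the registered stub. -/
theorem AbhyankarReduction_of : CyclicCovers.AbhyankarReduction :=
  AbhyankarReduction_of_stubs stub_smoothFibreLeaf

/-! ## The redirect, stated without concluding the crux by name (the by-name versions
`abhyankarReduction_of_torsorToLurel`, `abhyankarReduction_of_temkin2013Relative`,
`abhyankarReduction_of_smoothFibre` are proposed as
`Theorems/CyclicCoversAbhyankarReductionOfTorsorToLurel.lean`) -/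

/-- The crux unfolds to "AS-ascent → ELU → Valuative's TorsorToLurel" — so route Valuative's
item `TorsorToLurel` (stmt-10968) implies it with `AsAscentRel`, `EluRegular` unused, and so do
`Temkin2013Relative` (via `Theorems.torsorToLurel_of_temkin2013Relative`) and the leaf (via
`Theorems.torsorToLurel_of_smoothFibre`). -/
theorem abhyankarReduction_iff :
    CyclicCovers.AbhyankarReduction ↔
      (CyclicCovers.AsAscentRel → CyclicCovers.EluRegular → Valuative.TorsorToLurel) :=
  Iff.rfl

/-- Temkin's theorem (corrected relative rendering) gives the unfolded crux. -/
theorem asAscent_elu_torsorToLurel_of_temkin2013Relative (hT : Temkin2013Relative.{0}) :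
    CyclicCovers.AsAscentRel → CyclicCovers.EluRegular → Valuative.TorsorToLurel :=
  fun _ _ => Theorems.torsorToLurel_of_temkin2013Relative hT

end Summit.ResolutionOfSingularities.ResolutionOfSingularities.Cruxes.AbhyankarReduction.ViaTorsorToLurel
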